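import Summits.Parity.GeneralizedHardyLittlewood.Theses.LiouvilleShiftedTables
import Literature.NumberTheory.Sieve.SingularSeriesProofs
import Literature.NumberTheory.Sieve.SingularSeriesPairProofs
import Literature.Computability.Complexity.SmallPrimesCRT

/-!
# `EngineToPairs` (stmt-Parity-14659): the shift boundary of the inlined pair asymptotic

Negative / boundary lemmas for the glue crux `LiouvilleShiftedTables.EngineToPairs`
(`DilatedTableChowla → TypeI2Dilated → ElliottHalberstam → ∀ h ≥ 1, Σ_{n≤N} Λ(n)Λ(n+h) = 𝔖({0,h})N + o(N)`),
landed from the crux work file `Cruxes/EngineToPairs/Disproof.lean` (§3–§5 there; cdisprove seat) so that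
provers of the support halves `PairsFromMAvg` / `SieveToMAvg`, ideators and planners can IMPORT them.
The odd-shift half of the conclusion (an unconditional theorem) and the reduction to even shifts are the
tree's `Theorems.PairsHL.pairsHL_odd` / `pairsHL_iff_even` (`LiouvilleShiftedTablesPairsHLOdd`, not imported
here only to keep this module's dependencies minimal).

* §1 the constant: `singularSeries_pair_zero : 𝔖({0,0}) = 𝔖({0}) = 1`, `singularSeries_pair_two : 𝔖({0,2}) = 2C₂`,
  and the factorwise comparison `singularSeries_pair_two_le : 𝔖({0,2}) ≤ 𝔖({0,h})` for even `h ≠ 0`, so that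
  `𝔖({0,h}) ≥ 2C₂ ≥ 1` UNIFORMLY in even shifts (`one_le_singularSeries_pair_of_even`).
* §2 the excluded shift: at `h = 0` the `PairsHL`-shaped statement reads `Σ_{n≤N} Λ(n)² = N + o(N)` and is
  FALSE (`pairsShape_false_at_zero`): `Σ_{n≤N} Λ(n)² ≥ N log N/8` for `N ≥ 2²⁴` (`sum_vonMangoldt_sq_ge`, from
  Chebyshev's `θ(N) ≥ N log 2/2`). So the clause `1 ≤ h` of the crux is load-bearing (`not_forall_shift`,
  `engineToPairs_false_without_shiftPos_of_hyps`); and `not_engineToPairs_iff : ¬EngineToPairs ↔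
  X1 ∧ X2 ∧ EH ∧ ¬PairsHL` records why no unconditional refutation of the glue crux can exist.
* §3 no uniformity in the shift: `∀ ε > 0, ∀ᶠ N, ∀ h ≥ 1, |Σ_{n≤N} Λ(n)Λ(n+h) − 𝔖({0,h})N| ≤ εN` is FALSE
  (`not_uniform_in_shift`): at the factorial shift `h = (N!)²` every term vanishes
  (`sum_factorial_sq_shift_eq_zero`) while `𝔖({0,h}) ≥ 1`. The witness is super-exponential in `N`: it records
  that the `o(N)` is necessarily non-uniform in `h` and says nothing about the polynomial range `|b| ≤ LN` of
  `PairsToGHL`. [folklore]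
-/

open Finset Filter Asymptotics ArithmeticFunction

noncomputable section

namespace Summit.Parity.GeneralizedHardyLittlewood.Theorems.EngineToPairs.Negative

open Literature.NumberTheory.Sieve
open Summit.Parity.GeneralizedHardyLittlewood.Theses.LiouvilleShiftedTables

/-! ## §1 The constant `𝔖({0,h})`: the values at `h = 0, 2` and a uniform lower bound at even shifts -/

/-- `{0, (0:ℤ)} = {0}` as finsets. [folklore] -/
theorem pair_zero : ({0, ((0 : ℕ) : ℤ)} : Finset ℤ) = {0} := by simp

/-- `ν_{0}(p) = 1`. [folklore] -/
theorem tupleResidueCount_singleton_zero (p : ℕ) : tupleResidueCount ({0} : Finset ℤ) p = 1 := by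
  simp [tupleResidueCount]

/-- The Euler factor of the one-point tuple `{0}` is `1` at every prime. [folklore] -/
theorem singularSeriesFactor_singleton_zero {p : ℕ} (hp : p.Prime) :
    singularSeriesFactor ({0} : Finset ℤ) p = 1 := by
  have hp1 : (1 : ℝ) < p := by exact_mod_cast hp.one_lt
  have hne : (1 : ℝ) - 1 / p ≠ 0 := by
    have : (1 : ℝ) / p < 1 := by rw [div_lt_one (by linarith)]; exact hp1
    linarith
  simp only [singularSeriesFactor, tupleResidueCount_singleton_zero, Finset.card_singleton, pow_one,
    Nat.cast_one]
  exact mul_inv_cancel₀ hne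

/-- The partial products of `𝔖({0})` are all `1`. [folklore] -/
theorem singularSeriesPartial_singleton_zero (x : ℕ) :
    singularSeriesPartial ({0} : Finset ℤ) x = 1 :=
  Finset.prod_eq_one fun _ hp => singularSeriesFactor_singleton_zero (Nat.prime_of_mem_primesLE hp)

/-- `𝔖({0}) = 1`. [folklore] -/
theorem singularSeries_singleton_zero : singularSeries ({0} : Finset ℤ) = 1 := by
  have h : singularSeriesPartial ({0} : Finset ℤ) = fun _ => 1 :=
    funext singularSeriesPartial_singleton_zero
  rw [singularSeries, h]
  exact tendsto_const_nhds.limUnder_eq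

/-- `𝔖({0,0}) = 𝔖({0}) = 1`: at the excluded shift `h = 0` the constant of the `PairsHL` shape is `1`.
[folklore] -/
theorem singularSeries_pair_zero : singularSeries ({0, ((0 : ℕ) : ℤ)} : Finset ℤ) = 1 := by
  rw [pair_zero, singularSeries_singleton_zero]

/-- `𝔖({0,2}) = 2C₂` in the `ℕ`-cast form of the route statements (tree: `singularSeries_pair_holds`).
[cite: HardyLittlewood1923, Conjecture B] -/
theorem singularSeries_pair_two : singularSeries ({0, ((2 : ℕ) : ℤ)} : Finset ℤ) = 2 * twinPrimeConst := by
  push_cast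
  exact singularSeries_pair_holds

/-- `1 ≤ 𝔖({0,2})` (`C₂ ≥ 1/2`, tree: `half_le_twinPrimeConst`). [folklore] -/
theorem one_le_singularSeries_pair_two : 1 ≤ singularSeries ({0, ((2 : ℕ) : ℤ)} : Finset ℤ) := by
  rw [singularSeries_pair_two]
  have := half_le_twinPrimeConst
  linarith

/-- `ν_{0,h}(2) = 1` for even `h`. [folklore] -/
theorem tupleResidueCount_pair_two_of_even {h : ℕ} (hh : Even h) :
    tupleResidueCount ({0, (h : ℤ)} : Finset ℤ) 2 = 1 := by
  have h0 : ((h : ℤ) : ZMod 2) = 0 := by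
    rw [Int.cast_natCast]; exact ZMod.natCast_eq_zero_iff_even.mpr hh
  simp only [tupleResidueCount, Finset.image_insert, Finset.image_singleton, Int.cast_zero, h0]
  decide

/-- For a prime `p`, `ν_{0,h}(p) ≤ ν_{0,2}(p)` when `h` is even. [folklore] -/
theorem tupleResidueCount_pair_le {h : ℕ} (hh : Even h) {p : ℕ} (hp : p.Prime) :
    tupleResidueCount ({0, (h : ℤ)} : Finset ℤ) p ≤ tupleResidueCount ({0, 2} : Finset ℤ) p := by
  rcases hp.eq_two_or_odd' with rfl | hodd
  · rw [tupleResidueCount_pair_two_of_even hh]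
    have : tupleResidueCount ({0, ((2 : ℕ) : ℤ)} : Finset ℤ) 2 = 1 :=
      tupleResidueCount_pair_two_of_even (by decide)
    push_cast at this
    omega
  · have h2 : 2 < p := lt_of_le_of_ne hp.two_le (fun h2 => by
      rw [← h2] at hodd; exact (Nat.not_odd_iff_even.mpr (by decide)) hodd)
    rw [tupleResidueCount_pair_of_two_lt h2]
    exact (tupleResidueCount_le_card _ _).trans (Finset.card_insert_le _ _)

/-- Factorwise comparison of Euler factors: `factor_{0,2}(p) ≤ factor_{0,h}(p)` for even `h ≠ 0`. [folklore] -/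
theorem singularSeriesFactor_pair_le {h : ℕ} (hh : Even h) (h0 : h ≠ 0) {p : ℕ} (hp : p.Prime) :
    singularSeriesFactor ({0, 2} : Finset ℤ) p ≤ singularSeriesFactor ({0, (h : ℤ)} : Finset ℤ) p := by
  have hc2 : ({0, 2} : Finset ℤ).card = 2 := Finset.card_pair (by decide)
  have hch : ({0, (h : ℤ)} : Finset ℤ).card = 2 := Finset.card_pair (by exact_mod_cast h0.symm)
  have hp0 : (0 : ℝ) < p := by exact_mod_cast hp.pos
  have hν : (tupleResidueCount ({0, (h : ℤ)} : Finset ℤ) p : ℝ) ≤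
      tupleResidueCount ({0, 2} : Finset ℤ) p := by exact_mod_cast tupleResidueCount_pair_le hh hp
  unfold singularSeriesFactor
  rw [hc2, hch]
  apply mul_le_mul_of_nonneg_right _ (pow_nonneg (inv_nonneg.mpr _) _)
  · have := div_le_div_of_nonneg_right hν hp0.le
    linarith
  · rw [sub_nonneg, div_le_one hp0]
    exact_mod_cast hp.one_le

/-- Partial products compare: `∏_{p≤x} factor_{0,2}(p) ≤ ∏_{p≤x} factor_{0,h}(p)` for even `h ≠ 0`. [folklore] -/
theorem singularSeriesPartial_pair_le {h : ℕ} (hh : Even h) (h0 : h ≠ 0) (x : ℕ) :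
    singularSeriesPartial ({0, 2} : Finset ℤ) x ≤ singularSeriesPartial ({0, (h : ℤ)} : Finset ℤ) x :=
  Finset.prod_le_prod (fun _ hp => singularSeriesFactor_nonneg _ (Nat.prime_of_mem_primesLE hp))
    fun _ hp => singularSeriesFactor_pair_le hh h0 (Nat.prime_of_mem_primesLE hp)

/-- `𝔖({0,2}) ≤ 𝔖({0,h})` for every even `h ≠ 0` (the twin constant is the smallest even-shift constant).
[folklore] -/
theorem singularSeries_pair_two_le {h : ℕ} (hh : Even h) (h0 : h ≠ 0) :
    singularSeries ({0, 2} : Finset ℤ) ≤ singularSeries ({0, (h : ℤ)} : Finset ℤ) :=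
  le_of_tendsto_of_tendsto' (tendsto_singularSeriesPartial_holds _)
    (tendsto_singularSeriesPartial_holds _) (singularSeriesPartial_pair_le hh h0)

/-- UNIFORM lower bound at even shifts: `1 ≤ 2C₂ ≤ 𝔖({0,h})` for every even `h ≠ 0`. [folklore] -/
theorem one_le_singularSeries_pair_of_even {h : ℕ} (hh : Even h) (h0 : h ≠ 0) :
    1 ≤ singularSeries ({0, (h : ℤ)} : Finset ℤ) := by
  have h2 := singularSeries_pair_two_le hh h0
  have h1 := one_le_singularSeries_pair_two
  push_cast at h1
  linarith

/-! ## §2 The excluded shift `h = 0`: `Σ Λ² = N + o(N)` is false, so `1 ≤ h` is load-bearing -/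

/-- Chebyshev-type lower bound: `Σ_{n ≤ N} Λ(n)Λ(n+0) = Σ_{n≤N} Λ(n)² ≥ N log N / 8` for `N ≥ 2²⁴`
(primes `p ∈ (√N, N]` contribute `(log p)² ≥ (log N/2) log p`, and `θ(N) − θ(√N) ≥ N/4`). [folklore] -/
theorem sum_vonMangoldt_sq_ge {N : ℕ} (hN : 2 ^ 24 ≤ N) :
    (N : ℝ) * Real.log N / 8 ≤ ∑ n ∈ Icc 1 N, vonMangoldt n * vonMangoldt (n + 0) := by
  classical
  set s := Nat.sqrt N with hs
  have hsN : s ≤ N := Nat.sqrt_le_self N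
  have hsub : Nat.primesLE s ⊆ Nat.primesLE N := Nat.primesLE_mono hsN
  set Q := Nat.primesLE N \ Nat.primesLE s with hQ
  have hθN : (N : ℝ) * Real.log 2 / 2 ≤ ∑ p ∈ Nat.primesLE N, Real.log p := by
    rw [← Chebyshev.theta_eq_sum_primesLE_log]
    exact Literature.Computability.Complexity.SmallPrimes.theta_ge_half hN
  have hθs : ∑ p ∈ Nat.primesLE s, Real.log p ≤ Real.log 4 * s := by
    rw [← Chebyshev.theta_eq_sum_primesLE_log]
    exact Chebyshev.theta_le_log4_mul_x (Nat.cast_nonneg s)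
  have hsplit : ∑ p ∈ Q, Real.log p
      = ∑ p ∈ Nat.primesLE N, Real.log p - ∑ p ∈ Nat.primesLE s, Real.log p := by
    rw [hQ, ← Finset.sum_sdiff hsub]; ring
  have hs12 : (2 ^ 12 : ℕ) ≤ s := by
    rw [hs, Nat.le_sqrt]
    calc 2 ^ 12 * 2 ^ 12 = 2 ^ 24 := by norm_num
      _ ≤ N := hN
  have hsR : (s : ℝ) * 2 ^ 12 ≤ N := by
    have h1 : s * s ≤ N := Nat.sqrt_le N
    have h2 : s * 2 ^ 12 ≤ s * s := Nat.mul_le_mul_left s hs12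
    exact_mod_cast h2.trans h1
  have hlog4 : Real.log 4 < 2 := by
    have : Real.log 4 = 2 * Real.log 2 := by
      rw [show (4 : ℝ) = 2 ^ 2 by norm_num, Real.log_pow]; norm_num
    rw [this]; have := Real.log_two_lt_d9; linarith
  have hlog2 : (0.69 : ℝ) < Real.log 2 := by have := Real.log_two_gt_d9; linarith
  have hN0 : (0 : ℝ) < N := by exact_mod_cast (lt_of_lt_of_le (by norm_num) hN)
  have hQsum : (N : ℝ) / 4 ≤ ∑ p ∈ Q, Real.log p := by
    rw [hsplit]
    have hs0 : (0 : ℝ) ≤ s := Nat.cast_nonneg s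
    nlinarith
  have hterm : ∀ p ∈ Q, Real.log N / 2 * Real.log p ≤ vonMangoldt p * vonMangoldt (p + 0) := by
    intro p hp
    rw [hQ, Finset.mem_sdiff, Nat.mem_primesLE, Nat.mem_primesLE] at hp
    obtain ⟨⟨_, hpp⟩, hps⟩ := hp
    have hsp : s < p := by
      by_contra hle
      exact hps ⟨not_lt.mp hle, hpp⟩
    have hp2 : N < p * p :=
      calc N < (s + 1) * (s + 1) := Nat.lt_succ_sqrt N
        _ ≤ p * p := Nat.mul_le_mul hsp hsp
    have hlogp : Real.log N ≤ 2 * Real.log p := by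
      have hlp : Real.log ((p : ℝ) ^ 2) = 2 * Real.log p := by
        rw [Real.log_pow]; norm_num
      rw [← hlp]
      refine Real.log_le_log hN0 ?_
      exact_mod_cast (by nlinarith : N ≤ p ^ 2)
    have hlp0 : 0 ≤ Real.log (p : ℝ) := Real.log_natCast_nonneg _
    rw [add_zero, vonMangoldt_apply_prime hpp]
    nlinarith
  have hQsub : Q ⊆ Icc 1 N := by
    intro p hp
    rw [hQ, Finset.mem_sdiff, Nat.mem_primesLE] at hp
    exact Finset.mem_Icc.mpr ⟨hp.1.2.one_le, hp.1.1⟩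
  calc (N : ℝ) * Real.log N / 8 = Real.log N / 2 * (N / 4) := by ring
    _ ≤ Real.log N / 2 * ∑ p ∈ Q, Real.log p := by gcongr
    _ = ∑ p ∈ Q, Real.log N / 2 * Real.log p := by rw [Finset.mul_sum]
    _ ≤ ∑ p ∈ Q, vonMangoldt p * vonMangoldt (p + 0) := Finset.sum_le_sum hterm
    _ ≤ ∑ n ∈ Icc 1 N, vonMangoldt n * vonMangoldt (n + 0) :=
        Finset.sum_le_sum_of_subset_of_nonneg hQsub fun _ _ _ =>
          mul_nonneg vonMangoldt_nonneg vonMangoldt_nonneg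

/-- **The shift `0` is excluded for cause.** The `PairsHL`-shaped statement at `h = 0`,
`Σ_{n≤N} Λ(n)Λ(n+0) − 𝔖({0,0})·N = o(N)`, i.e. `Σ_{n≤N} Λ(n)² = N + o(N)`, is FALSE. Hence the clause
`1 ≤ h` in `EngineToPairs` / `PairsHL` is load-bearing. [folklore] -/
theorem pairsShape_false_at_zero :
    ¬ ((fun N : ℕ => ∑ n ∈ Finset.Icc 1 N, ArithmeticFunction.vonMangoldt n *
        ArithmeticFunction.vonMangoldt (n + 0)
        - Literature.NumberTheory.Sieve.singularSeries ({0, ((0 : ℕ) : ℤ)} : Finset ℤ) * N)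
      =o[Filter.atTop] fun N : ℕ => (N : ℝ)) := by
  intro hC
  rw [singularSeries_pair_zero] at hC
  have hev := hC.def (by norm_num : (0 : ℝ) < 1 / 2)
  obtain ⟨N, hb, hN⟩ := (hev.and (eventually_ge_atTop (2 ^ 24))).exists
  have hlow := sum_vonMangoldt_sq_ge hN
  have hN0 : (0 : ℝ) < N := by exact_mod_cast (lt_of_lt_of_le (by norm_num) hN)
  rw [one_mul, Real.norm_eq_abs, Real.norm_of_nonneg hN0.le] at hb
  have hup := (abs_le.mp hb).2
  have hlogN : (16 : ℝ) ≤ Real.log N := by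
    have h2 : (2 : ℝ) ^ 24 ≤ N := by exact_mod_cast hN
    have := Real.log_le_log (by positivity) h2
    rw [Real.log_pow] at this
    have := Real.log_two_gt_d9
    push_cast at *
    nlinarith
  nlinarith

/-- No version of the pair asymptotic can include the shift `0`. [folklore] -/
theorem not_forall_shift :
    ¬ ∀ h : ℕ, (fun N : ℕ => ∑ n ∈ Finset.Icc 1 N, ArithmeticFunction.vonMangoldt n *
        ArithmeticFunction.vonMangoldt (n + h)
        - Literature.NumberTheory.Sieve.singularSeries ({0, (h : ℤ)} : Finset ℤ) * N)
      =o[Filter.atTop] fun N : ℕ => (N : ℝ) :=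
  fun H => pairsShape_false_at_zero (H 0)

/-- `¬EngineToPairs` is EXACTLY `X1 ∧ X2 ∧ EH ∧ ¬PairsHL`: an unconditional refutation of the glue crux would have
to prove both engine cruxes and the Elliott–Halberstam conjecture and disprove Hardy–Littlewood pairs at some
fixed shift (conversely a refutation of either engine crux proves it vacuously). [folklore] -/
theorem not_engineToPairs_iff :
    ¬ EngineToPairs ↔ DilatedTableChowla ∧ TypeI2Dilated ∧ ElliottHalberstam ∧ ¬ PairsHL := by
  have e : EngineToPairs ↔ (DilatedTableChowla → TypeI2Dilated → ElliottHalberstam → PairsHL) := Iff.rfl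
  rw [e]
  tauto

/-- The crux with the clause `1 ≤ h` dropped is FALSE modulo its own three hypotheses: `1 ≤ h` is
load-bearing for `EngineToPairs` (by `pairsShape_false_at_zero`). [folklore] -/
theorem engineToPairs_false_without_shiftPos_of_hyps (hD : DilatedTableChowla) (hI : TypeI2Dilated)
    (hE : ElliottHalberstam) :
    ¬ (DilatedTableChowla → TypeI2Dilated → ElliottHalberstam → ∀ h : ℕ,
        (fun N : ℕ => ∑ n ∈ Finset.Icc 1 N, ArithmeticFunction.vonMangoldt n *
            ArithmeticFunction.vonMangoldt (n + h)
            - Literature.NumberTheory.Sieve.singularSeries ({0, (h : ℤ)} : Finset ℤ) * N)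
          =o[Filter.atTop] fun N : ℕ => (N : ℝ)) :=
  fun H => not_forall_shift (H hD hI hE)

/-! ## §3 No uniformity in the shift -/

/-- At the factorial shift `h = (N!)²` every term of `Σ_{n≤N} Λ(n)Λ(n+h)` vanishes: if `n = p^j ≤ N` then
`p^{j+1} ∣ (N!)²`, so `p^j + (N!)²` is `p^j` times a cofactor `≡ 1 (mod p)`, not a prime power. [folklore] -/
theorem sum_factorial_sq_shift_eq_zero (N : ℕ) :
    ∑ n ∈ Icc 1 N, vonMangoldt n * vonMangoldt (n + (Nat.factorial N) ^ 2) = 0 := by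
  apply Finset.sum_eq_zero
  intro n hn
  rw [Finset.mem_Icc] at hn
  by_contra hne
  have h1 : IsPrimePow n := vonMangoldt_ne_zero_iff.mp (left_ne_zero_of_mul hne)
  have h2 : IsPrimePow (n + (Nat.factorial N) ^ 2) :=
    vonMangoldt_ne_zero_iff.mp (right_ne_zero_of_mul hne)
  rw [isPrimePow_nat_iff] at h1 h2
  obtain ⟨p, j, hp, hj, rfl⟩ := h1
  obtain ⟨q, i, hq, _, hqi⟩ := h2
  set F := (Nat.factorial N) ^ 2 with hF
  have hpjF : p ^ j ∣ Nat.factorial N := Nat.dvd_factorial (pow_pos hp.pos j) hn.2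
  have hF2 : p ^ (2 * j) ∣ F := by
    rw [hF, pow_mul']
    exact pow_dvd_pow_of_dvd hpjF 2
  have hFj1 : p ^ (j + 1) ∣ F := (pow_dvd_pow p (by omega : j + 1 ≤ 2 * j)).trans hF2
  have hpF : p ∣ F := (dvd_pow_self p (by omega : j + 1 ≠ 0)).trans hFj1
  have hpqi : p ∣ q ^ i := by
    rw [hqi]
    exact dvd_add (dvd_pow_self p hj.ne') hpF
  have hpq : p = q := (Nat.prime_dvd_prime_iff_eq hp hq).mp (hp.dvd_of_dvd_pow hpqi)
  subst hpq
  have hij : j < i := by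
    have hlt : p ^ j < p ^ i := by
      rw [hqi]
      have : 0 < F := by positivity
      omega
    exact (Nat.pow_lt_pow_iff_right hp.one_lt).mp hlt
  have hdiv : p ^ (j + 1) ∣ p ^ j := by
    have h3 : p ^ (j + 1) ∣ p ^ j + F := by
      rw [← hqi]; exact pow_dvd_pow p (by omega)
    obtain ⟨c, hc⟩ := h3
    obtain ⟨d, hd⟩ := hFj1
    refine ⟨c - d, ?_⟩
    rw [Nat.mul_sub, ← hc, ← hd]
    omega
  have := (Nat.pow_dvd_pow_iff_le_right hp.one_lt).mp hdiv
  omega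

/-- **No uniformity in the shift.** The natural strengthening of `PairsHL` in which the `o(N)` is uniform
over all shifts `h ≥ 1` is FALSE (witness: `ε = 1/2`, any large `N`, `h = (N!)²`). [folklore] -/
theorem not_uniform_in_shift :
    ¬ ∀ ε : ℝ, 0 < ε → ∀ᶠ N : ℕ in atTop, ∀ h : ℕ, 1 ≤ h →
      |∑ n ∈ Icc 1 N, vonMangoldt n * vonMangoldt (n + h)
        - singularSeries ({0, (h : ℤ)} : Finset ℤ) * N| ≤ ε * N := by
  intro H
  obtain ⟨N, hN, hN2⟩ := ((H (1 / 2) (by norm_num)).and (eventually_ge_atTop 2)).exists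
  set h := (Nat.factorial N) ^ 2 with hh
  have hfac2 : 2 ∣ Nat.factorial N := Nat.dvd_factorial two_pos hN2
  have heven : Even h := by
    rw [hh, even_iff_two_dvd]
    exact hfac2.trans (dvd_pow_self _ two_ne_zero)
  have h0 : h ≠ 0 := pow_ne_zero 2 (Nat.factorial_pos N).ne'
  have h1 : 1 ≤ h := Nat.one_le_iff_ne_zero.mpr h0
  have hb := hN h h1
  rw [hh, sum_factorial_sq_shift_eq_zero N, ← hh, zero_sub, abs_neg] at hb
  have hHL : 1 ≤ singularSeries ({0, (h : ℤ)} : Finset ℤ) := one_le_singularSeries_pair_of_even heven h0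
  have hN0 : (0 : ℝ) < N := by exact_mod_cast (lt_of_lt_of_le two_pos hN2)
  rw [abs_of_nonneg (mul_nonneg (singularSeries_nonneg_holds _) hN0.le)] at hb
  nlinarith

end Summit.Parity.GeneralizedHardyLittlewood.Theorems.EngineToPairs.Negative

end
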